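import Literature.AnabelianGeometry.EtaleTheta.TemperedFrobenioidOfGaloisCoveringTateTowerArith
import Literature.AnabelianGeometry.EtaleTheta.Discharge.Sec3Cor38iiiKnitRankOnePointTateTower

/-!
# [EtTh] Prop. 3.4 (ii) bundle `Prop34Const` and Cor. 3.8 (iii) (first clause) at the ARITHMETIC Tate tower, with no
# hypothesis

S. Mochizuki, *The étale theta function …*, Publ. RIMS **45** (2009) [MochizukiEtTh2009], §3, Prop. 3.4 (ii) (PRIMS PDF
p.74: "`O_L^× ⥲ Ker(B₀ → Φ₀^gp)`, … `L^× ⥲ F₀(Y^log)`"; the line `div₀(c) = v_L(c)·div(ϖ_L)` of non-cuspidal divisors of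
constants) and Cor. 3.8 (iii) (p.81) [cite: MochizukiEtTh2009, Prop 3.4 p.74].

PROOF-ONLY (abc-iut cell, W6 seat d058 lineage, gen 3; 0 defs; L2-lead R448 «Prop34Const/Cor3.8(iii) port at
TateTowerArith» part 2).  abc-iut-L2-t3's bundle `DivisorMonoids.Prop34Const` (clauses (a) `F₀` inverse-closed, (b) a
non-cuspidal `d ≠ 0` with `d = div₀(ϖ)`, `ϖ ∈ F₀`, and `div₀(F₀) ⊆ d^ℤ`) was proved at the Tate tower SKELETON by
abc-iut-w6-d052 (p448109, `Sec3Prop34ConstTateTower.lean`: constants `ϖ^c`, `div₀(ϖ^c) = c·Σ_j[F_j]`).  Here the same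
at the ARITHMETIC Tate tower `TateTowerArith.Datum.model/action D` (p450534; constants a valued field `L`, Galois group
`ℤ × Aut(L/K)`), where the line of constants reads GENUINELY as in print: for a constant `c ∈ L^×`,
`div₀(c·U^0) = ord(c)·Σ_j[F_j] = ord(c)·div₀(q)` with `q` the `K`-rational Tate parameter (`ord q = 1`) — i.e.
"`div₀(c) = v_L(c)·div(ϖ_L)`":
* `Datum.divAt_eq_constDIV_ord` — the divisor of a constant-valued family at a point is `ord(c)·Σ_j[F_j]`;
* `Datum.exists_forall_ord_eq_of_mem_fZero` — on a transitive `ℤ × Aut(L/K)`-set an element of `F₀(S)` has values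
  `σ(c)·U^0` of ONE order `ord c` (`ord ∘ σ = ord`);
* `Datum.divZero_eq_zpow_ord` — hence `div₀ b = [Σ_j F_j]^{ord c}`; `Datum.qFamily_mem_fZero` / `divZero_qFamily` —
  `q·U^0 ∈ F₀(S)` with `div₀ = Σ_j[F_j]`;
* **`Datum.prop34Const : (ofGaloisActionConnected D.action D.cuspLaws).Prop34Const`** — no hypothesis;
* **`Datum.cor38_iii_ofRankOnePoint_unconditional`** / `cor38_iii_tateTowerArithFrd_unconditional` /
  `exists_cor38Hyp_cor38_iii_unconditional` — [EtTh] Cor. 3.8 (iii), first clause, for EVERY Cor. 3.8 datum between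
  rank-one-point tempered Frobenioids over the arithmetic tower (abc-iut-w6-d052's knit `cor38_iii_ofRankOnePoint`
  BY NAME; `Countable (ℤ × Aut(L/K))` from finiteness of `Aut(L/K)`), WITH NO HYPOTHESIS.
With `Datum.rat p` (p451242) every statement is non-vacuous.  HONEST FRAMING: instantiation / consistency evidence at
a synthetic model; nothing of [EtTh] asserted beyond what is proved; nothing here bears on [IUTchIII] Cor. 3.12; no side
taken; typed ≠ proved — here proved.
-/

noncomputable section

namespace Literature.AnabelianGeometry.EtaleTheta

open CategoryTheory Opposite Literature.AlgebraicGeometry.Frobenioids LogDivisorModel.GaloisAction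
  LogDivisorModel.TateTower TateTowerFrd

namespace LogDivisorModel.TateTowerArith.Datum

variable {K L : Type} [Field K] [Field L] [Algebra K L] (D : Datum K L) (S : Action (Type 0) (Grp K L))

/-! ### Constants and their divisors in the arithmetic tower -/

/-- The action of `(t, σ)` on log-divisors is the translation `shiftDIV t`. [cite: MochizukiEtTh2009, Def 3.3 p.73] -/
theorem actDIV_eq_shiftDIV (g : Grp K L) (d : D.model.DIV) :
    D.action.actDIV g d = shiftDIV (Multiplicative.toAdd g.1) d := rfl

/-- A constant of the arithmetic tower is `c·U^0` for some `c ∈ L^×`. [cite: MochizukiEtTh2009, Def 3.1 p.70] -/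
theorem exists_eq_of_mem_const {f : D.model.Fn} (hf : f ∈ D.model.const) : ∃ c : Lˣ, f = (c, 1) := by
  obtain ⟨c, rfl⟩ := hf
  exact ⟨c, rfl⟩

/-- **`div(c·U^0) = ord(c)·Σ_j [F_j]`**: the divisor of a constant-valued family at a point.
[cite: MochizukiEtTh2009, Prop 3.4 p.74] -/
theorem divAt_eq_constDIV_ord (b : D.action.bZero S) (s : S.V) (c : Lˣ) (hc : b.1 s = (c, 1)) :
    D.action.divAt S b s = constDIV (D.ord c) := by
  change D.divHom (b.1 s) = constDIV (D.ord c)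
  rw [hc]
  refine Multiplicative.toAdd.injective (funext fun x => ?_)
  rw [Datum.toAdd_divHom, toAdd_one, zero_mul, add_zero]
  rfl

/-- **On a TRANSITIVE `ℤ × Aut(L/K)`-set an element of `F₀(S)` has values `σ(c)·U^0` of ONE order**: `ord (b s) = ord c`
for all `s` (`ord ∘ σ = ord`, the twist `q^{−0·t}` is trivial). [cite: MochizukiEtTh2009, Prop 3.4 p.74] -/
theorem exists_forall_ord_eq_of_mem_fZero (hS : ∀ s t : S.V, ∃ g : Grp K L, S.ρ g s = t) (s₀ : S.V)
    (b : D.action.bZero S) (hb : b ∈ D.action.fZero S) :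
    ∃ c : Lˣ, ∀ s, ∃ c' : Lˣ, b.1 s = (c', 1) ∧ D.ord c' = D.ord c := by
  obtain ⟨c, hc⟩ := D.exists_eq_of_mem_const (hb s₀)
  refine ⟨c, fun s => ?_⟩
  obtain ⟨g, rfl⟩ := hS s₀ s
  refine ⟨(D.act g (c, 1)).1, ?_, ?_⟩
  · rw [b.2.2 g s₀, hc]
    rfl
  · rw [Datum.act_fst, toAdd_one, zero_mul, neg_zero, zpow_zero, mul_one, Datum.ord_map]

/-- **`div₀(b) = [Σ_j F_j]^{ord c}`** for `b ∈ F₀(S)` over a transitive `S` (both signs of `ord c`; abc-iut-w6-d052's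
two-sided `divZero_eq_div_iff` bookkeeping with `constDIV`). [cite: MochizukiEtTh2009, Prop 3.4 p.74] -/
theorem divZero_eq_zpow_ord (d : D.action.phiZero S) (hd : ∀ s, d.1 s = (constDIV 1 : D.model.DIV))
    (b : D.action.bZero S) (c : Lˣ) (hc : ∀ s, ∃ c' : Lˣ, b.1 s = (c', 1) ∧ D.ord c' = D.ord c) :
    D.action.divZero S b = Algebra.GrothendieckGroup.of d ^ D.ord c := by
  have hdpow : ∀ (n : ℕ) s, (d ^ n).1 s = (constDIV n : D.model.DIV) := fun n s => by
    rw [SubmonoidClass.coe_pow, Pi.pow_apply, hd]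
    exact constDIV_one_pow n
  have hdiv : ∀ s, D.action.divAt S b s = constDIV (D.ord c) := fun s => by
    obtain ⟨c', hc', hord⟩ := hc s
    rw [D.divAt_eq_constDIV_ord S b s c' hc', hord]
  obtain ⟨n, hn | hn⟩ := Int.eq_nat_or_neg (D.ord c)
  · rw [hn, zpow_natCast, ← map_pow, ← div_one (Algebra.GrothendieckGroup.of (d ^ n)),
      ← map_one Algebra.GrothendieckGroup.of, D.action.divZero_eq_div_iff]
    intro s
    rw [hdiv s, hn, OneMemClass.coe_one, Pi.one_apply, mul_one, hdpow]
  · rw [hn, zpow_neg, zpow_natCast, ← map_pow, ← one_div, ← map_one Algebra.GrothendieckGroup.of,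
      D.action.divZero_eq_div_iff]
    intro s
    rw [hdiv s, hn, OneMemClass.coe_one, Pi.one_apply, hdpow]
    exact constDIV_neg_mul n

/-- **The reduced special fibre `Σ_j [F_j] ∈ Φ₀(S)`** for every `ℤ × Aut(L/K)`-set `S` (effective Cartier, invariant).
[cite: MochizukiEtTh2009, Def 3.3 p.73] -/
theorem constDIV_one_mem_phiZero : (fun _ : S.V => (constDIV 1 : D.model.DIV)) ∈ D.action.phiZero S :=
  ⟨fun _ => TateTowerArithFrd.constDIV_mem_Divplus D 1, fun g _ => by rw [actDIV_eq_shiftDIV, shiftDIV_constDIV]⟩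

/-- **The `K`-rational Tate parameter `q·U^0` as an element of `B₀(S)`** for every `S` (invariant under `ℤ × Aut(L/K)`).
[cite: MochizukiEtTh2009, Def 3.3 p.73] -/
theorem qFamily_mem_bZero : (fun _ : S.V => ((D.qUnit, 1) : D.model.Fn)) ∈ D.action.bZero S :=
  ⟨fun _ => trivial, fun g _ => by
    change ((D.qUnit, 1) : Lˣ × Multiplicative ℤ) = D.act g (D.qUnit, 1)
    have h := TateTowerArithFrd.act_qUnit_zpow D g 1
    rw [zpow_one] at h
    exact h.symm⟩

/-- `q·U^0 ∈ F₀(S)`. [cite: MochizukiEtTh2009, Def 3.3 p.73] -/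
theorem qFamily_mem_fZero : (⟨_, D.qFamily_mem_bZero S⟩ : D.action.bZero S) ∈ D.action.fZero S :=
  fun _ => ⟨D.qUnit, rfl⟩

/-! ### Clause (b) and the bundle, with no hypothesis -/

/-- **Clause (b) of `Prop34Const` at the arithmetic tower, for every CONNECTED covering `S`**: `d := Σ_j [F_j] ∈ Φ₀(S)` is
non-cuspidal, `≠ 0`, equals `div₀(q·U^0)` for the `K`-rational constant `q ∈ F₀(S)`, and `div₀(b) = ord(c) • d` for every
`b ∈ F₀(S)` (values `σ(c)·U^0`) — print's "`div₀(c) = v_L(c)·div(ϖ_L)`". [cite: MochizukiEtTh2009, Prop 3.4 p.74] -/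
theorem exists_specialFibre_phiZero (hS : isConnectedGSet S) :
    ∃ d ∈ D.action.ncspZero S, d ≠ 1 ∧
      (∃ ϖ ∈ D.action.fZero S, D.action.divZeroHom S ϖ = Algebra.GrothendieckGroup.of d) ∧
      ∀ b ∈ D.action.fZero S, ∃ n : ℤ, D.action.divZeroHom S b = Algebra.GrothendieckGroup.of d ^ n := by
  obtain ⟨⟨s₀⟩, htrans⟩ := hS
  let d : D.action.phiZero S := ⟨_, D.constDIV_one_mem_phiZero S⟩
  have hd : ∀ s, d.1 s = (constDIV 1 : D.model.DIV) := fun _ => rfl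
  refine ⟨d, fun _ => trivial, fun h => constDIV_one_ne_one ((hd s₀).symm.trans (by rw [h]; rfl)), ?_, ?_⟩
  · refine ⟨⟨_, D.qFamily_mem_bZero S⟩, D.qFamily_mem_fZero S, ?_⟩
    have h := D.divZero_eq_zpow_ord S d hd ⟨_, D.qFamily_mem_bZero S⟩ D.qUnit fun _ => ⟨D.qUnit, rfl, rfl⟩
    rw [Datum.ord_qUnit, zpow_one] at h
    exact h
  · intro b hb
    obtain ⟨c, hc⟩ := D.exists_forall_ord_eq_of_mem_fZero S htrans s₀ b hb
    exact ⟨D.ord c, D.divZero_eq_zpow_ord S d hd b c hc⟩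

/-- **[EtTh] Prop. 3.4 (ii), abc-iut-L2-t3's bundle `Prop34Const`, HOLDS at the Def. 3.3 (iii) data of the CONNECTED
coverings of the ARITHMETIC Tate tower** — no hypothesis (clause (a) by `exists_inv_mem_fZero`, clause (b) by
`exists_specialFibre_phiZero`). [cite: MochizukiEtTh2009, Prop 3.4 p.74] -/
theorem prop34Const : (DivisorMonoids.ofGaloisActionConnected D.action D.cuspLaws).Prop34Const where
  inv_mem_F₀ Y b hb := exists_inv_mem_fZero D.action Y.unop.obj b hb
  exists_specialFibre Y := D.exists_specialFibre_phiZero Y.unop.obj Y.unop.property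

/-! ### Cor. 3.8 (iii), first clause, at the arithmetic tower — no hypothesis -/

/-- `ℤ × Aut(L/K)` is countable (`Aut(L/K)` is finite for the finite extension `L/K`). [cite: MochizukiEtTh2009, Def 3.3 p.73] -/
theorem countable_grp (D : Datum K L) : Countable (Grp K L) := by
  haveI := D.finiteDimensional
  haveI : Countable (Multiplicative ℤ) := Countable.of_equiv ℤ Multiplicative.ofAdd
  infer_instance

section Cor38

variable (P P' : TemperedFrobenioid.RankOnePoint D.action)
  (hpf hpf' : ∀ Y : ((isConnectedGSet (G := Grp K L)).FullSubcategory)ᵒᵖ,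
    IsPerfFactorialCof ((DivisorMonoids.ofGaloisActionConnected D.action D.cuspLaws).Φ₀.obj Y))
  (R₁ S₁ R₂ S₂ : ((Discrete PUnit.{1})ᵒᵖ ⥤ CommMonCat.{0}) → Prop)

/-- **[EtTh] Cor. 3.8 (iii), first clause, AT THE ARITHMETIC TATE TOWER WITH NO HYPOTHESIS** (monoid type `ℤ`): for ANY
rank-one points and EVERY Cor. 3.8 datum `h` between the two rank-one-point tempered Frobenioids, `Cor38_iii h`
(abc-iut-w6-d052's knit `cor38_iii_ofRankOnePoint` fed with `prop34Const`). [cite: MochizukiEtTh2009, Cor 3.8 p.81] -/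
theorem cor38_iii_ofRankOnePoint_unconditional
    (h : Cor38Hyp (TemperedFrobenioid.ofRankOnePoint D.cuspLaws P hpf R₁ S₁)
      (TemperedFrobenioid.ofRankOnePoint D.cuspLaws P' hpf' R₂ S₂)) : Cor38_iii h := by
  haveI : Countable (Grp K L) := D.countable_grp
  haveI : Countable D.model.Cusp := show Countable PEmpty.{1} from inferInstance
  haveI : Countable D.model.Comp := show Countable ℤ from inferInstance
  exact TemperedFrobenioid.cor38_iii_ofRankOnePoint D.cuspLaws P hpf R₁ S₁ D.cuspLaws P' hpf' R₂ S₂ h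
    D.prop34Const D.prop34Const

/-- **∃-form, no hypothesis**: `Cor38_iii` is INHABITED at the arithmetic Tate tower. [cite: MochizukiEtTh2009, Cor 3.8 p.81] -/
theorem exists_cor38Hyp_cor38_iii_unconditional :
    ∃ h : Cor38Hyp (TemperedFrobenioid.ofRankOnePoint D.cuspLaws P hpf R₁ S₁)
      (TemperedFrobenioid.ofRankOnePoint D.cuspLaws P hpf R₁ S₁), Cor38_iii h := by
  haveI : Countable (Grp K L) := D.countable_grp
  haveI : Countable D.model.Cusp := show Countable PEmpty.{1} from inferInstance
  haveI : Countable D.model.Comp := show Countable ℤ from inferInstance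
  exact TemperedFrobenioid.exists_cor38Hyp_cor38_iii_ofRankOnePoint D.cuspLaws P hpf R₁ S₁ D.prop34Const

/-- **At the instance `TateTowerArithFrd.temperedFrobenioid`, no hypothesis.** [cite: MochizukiEtTh2009, Cor 3.8 p.81] -/
theorem cor38_iii_tateTowerArithFrd_unconditional
    (h : Cor38Hyp (TateTowerArithFrd.temperedFrobenioid D R₁ S₁) (TateTowerArithFrd.temperedFrobenioid D R₂ S₂)) :
    Cor38_iii h :=
  D.cor38_iii_ofRankOnePoint_unconditional _ _ _ _ R₁ S₁ R₂ S₂ h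

end Cor38

end LogDivisorModel.TateTowerArith.Datum

end Literature.AnabelianGeometry.EtaleTheta

end
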